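import Literature.Analysis.PDE.EvansKrylovJets
import Literature.Analysis.PDE.EvansKrylovSecondDifferentialAux
import HarnessLib

/-!
# Evans–Krylov: the twice-differentiated equation (Gilbarg–Trudinger (17.44)–(17.46))

The analytic heart of the interior `C^{2,α}` estimate for concave fully nonlinear equations
(Gilbarg–Trudinger, Thm. 17.14) in the coordinate-jet language of
`Literature/Analysis/Calculus/CoordinateJets.lean` and
`Literature/Analysis/PDE/EvansKrylovJets.lean`.

Let `u ∈ C⁴(O)` solve `F(y, θ, cjet₂ u(y)) = 0` on the open set `O`, `F ∈ C²`, and fix `y ∈ O`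
and a unit coordinate vector `γ` (`γ ⬝ᵥ γ = 1`, realised as `γ̂ = Σ γ_i e_i`).  Differentiating
the equation twice along the line `t ↦ y + tγ̂` (`second_differential_cjetOf_eq_zero`, GT (17.44))
gives `D²F(x₀)[V, V] + DF(x₀)[(0, 0, W)] = 0` at the jet point `x₀ = (y, θ, cjet₂ u(y))`, where
the top (second-order) slot of `V` carries the third derivatives `D³u(y)(γ̂, e_i, e_j)` and the top
slot of `W` the fourth derivatives `D⁴u(y)(γ̂, γ̂, e_i, e_j) = D²(D_{γγ}u)(y)(e_i, e_j)`
(`hessianMatrix_quadHess_apply`).  Splitting off the top slots, using the concavity of `F` in the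
top slot (`D²F(x₀)[(0,0,topJet Ω)]² ≤ 0` for symmetric `Ω`) and bounding the remaining terms by
`‖DF(x₀)‖, ‖D²F(x₀)‖ ≤ μ`, `‖Dᵐu(y)‖ ≤ K` (`m ≤ 2`) and the Hilbert–Schmidt size
`|D³u(y)|² = thirdSq u y` of the third derivatives (`sq_apply_le_sum_sq_apply`) yields
GT (17.45)–(17.46) in the form

`a(y) : D²h(y) ≥ -(A₀ |D³u(y)| + B₀)`, `h = D_{γγ}u = quadHess u γ`, `a = symbolMatrix F x₀`,

with `A₀ = μ(3 + 2K)`, `B₀ = μ((1 + K)² + K)` (`pair_symbolMatrix_hessian_quadHess_ge`).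
Everything here is proved; no named facts.

## References

* D. Gilbarg, N. S. Trudinger, *Elliptic Partial Differential Equations of Second Order* (2001),
  §17.4, (17.43)–(17.46). [GilbargTrudinger2001]
-/

noncomputable section

open Matrix Finset Metric Set
open scoped Topology InnerProductSpace RealInnerProductSpace

namespace Literature.Analysis.PDE.EvansKrylov

open Literature.Analysis.Calculus Literature.Analysis.PDE.ABP Literature.Analysis.PDE.KrylovSafonov

variable {ι : Type*} [Fintype ι] [DecidableEq ι]

omit [DecidableEq ι] in
/-- The realisation `γ̂ = Σ γ_i e_i` of a unit coordinate vector has norm one. [folklore] -/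
theorem norm_sum_smul_basisFun {γ : ι → ℝ} (hγ : γ ⬝ᵥ γ = 1) :
    ‖∑ i, γ i • EuclideanSpace.basisFun ι ℝ i‖ = 1 := by
  set bE := EuclideanSpace.basisFun ι ℝ with hbE
  have h1 : ∀ i, ⟪bE i, ∑ j, γ j • bE j⟫ = γ i := fun i => bE.orthonormal.inner_right_fintype γ i
  have h2 : ‖∑ j, γ j • bE j‖ ^ 2 = 1 := by
    rw [← bE.sum_sq_inner_right, ← hγ]
    simp only [h1, dotProduct, sq]
  rw [← Real.sqrt_sq (norm_nonneg (∑ j, γ j • bE j)), h2, Real.sqrt_one]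

omit [DecidableEq ι] in
/-- **The pure second derivative as a component of `D²u`**:
`quadHess u γ z = D²u(z)(γ̂, γ̂)`, `γ̂ = Σ γ_i e_i` (bilinearity). [folklore] -/
theorem quadHess_eq_iteratedFDeriv (u : EuclideanSpace ℝ ι → ℝ) (γ : ι → ℝ)
    (z : EuclideanSpace ℝ ι) :
    quadHess u γ z = iteratedFDeriv ℝ 2 u z
      ![∑ i, γ i • EuclideanSpace.basisFun ι ℝ i, ∑ i, γ i • EuclideanSpace.basisFun ι ℝ i] := by
  rw [quadHess_eq, dotProduct_hessianMatrix_mulVec, iteratedFDeriv_two_apply]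
  rfl

omit [DecidableEq ι] in
/-- **The Hessian of the pure second derivative is a component of `D⁴u`**: for `u` of class `C⁴`
at `y`, `D²(D_{γγ}u)(y)(e_i, e_j) = D⁴u(y)(e_i, e_j, γ̂, γ̂)`. [folklore] -/
theorem hessianMatrix_quadHess_apply {u : EuclideanSpace ℝ ι → ℝ} {y : EuclideanSpace ℝ ι}
    (hu : ContDiffAt ℝ 4 u y) (γ : ι → ℝ) (i j : ι) :
    hessianMatrix (quadHess u γ) (EuclideanSpace.basisFun ι ℝ) y i j =
      iteratedFDeriv ℝ 4 u y ![EuclideanSpace.basisFun ι ℝ i, EuclideanSpace.basisFun ι ℝ j,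
        ∑ i, γ i • EuclideanSpace.basisFun ι ℝ i, ∑ i, γ i • EuclideanSpace.basisFun ι ℝ i] := by
  rw [hessianMatrix_apply, show quadHess u γ = fun z => iteratedFDeriv ℝ 2 u z
      ![∑ i, γ i • EuclideanSpace.basisFun ι ℝ i, ∑ i, γ i • EuclideanSpace.basisFun ι ℝ i] from
    funext (quadHess_eq_iteratedFDeriv u γ)]
  have hu' : ContDiffAt ℝ (2 + 2 : ℕ) u y := hu.of_le (by norm_num)
  exact fderiv_fderiv_iteratedFDeriv_apply_const hu' _ _ _

/-- **Gilbarg–Trudinger (17.45)–(17.46) in jet form.** Constants `A₀, B₀ ≥ 0` depending only on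
`μ, K` (and `ι`) such that: if `u ∈ C⁴(O)` solves `F(y, θ, cjet₂u(y)) = 0` on the open set `O`
with `F ∈ C²`, and at the point `y ∈ O` the derivatives of `u` of orders `≤ 2` are bounded by `K`,
`‖DF‖, ‖D²F‖ ≤ μ` at the jet of `u` at `y`, and `F` is concave in the top slot at that jet
(`D²F[(0,0,topJet Ω)]² ≤ 0` for symmetric `Ω`), then for every unit coordinate vector `γ` the pure
second derivative `h = D_{γγ}u = quadHess u γ` satisfies
`a(y) : D²h(y) ≥ −(A₀ |D³u(y)| + B₀)`, `a = symbolMatrix F (jet)`, `|D³u|² = thirdSq u y`.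
[cite: GilbargTrudinger2001, §17.4, (17.44)–(17.46)] -/
theorem pair_symbolMatrix_hessian_quadHess_ge (ι : Type*) [Fintype ι] [DecidableEq ι]
    (P : Type*) [NormedAddCommGroup P] [NormedSpace ℝ P] {μ K : ℝ} (hμ : 0 ≤ μ) (hK : 0 ≤ K) :
    ∃ A₀ B₀ : ℝ, 0 ≤ A₀ ∧ 0 ≤ B₀ ∧
      ∀ {O : Set (EuclideanSpace ℝ ι)}, IsOpen O →
      ∀ {u : EuclideanSpace ℝ ι → ℝ}, ContDiffOn ℝ 4 u O →
      ∀ {F : EuclideanSpace ℝ ι × P × CJet ι 2 → ℝ} {θ : P},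
        ContDiffOn ℝ 2 F {x | x.1 ∈ O} →
        (∀ y ∈ O, F (y, θ, cjetOf (EuclideanSpace.basisFun ι ℝ) 2 u y) = 0) →
      ∀ {y : EuclideanSpace ℝ ι}, y ∈ O →
        (∀ m ≤ 2, ‖iteratedFDeriv ℝ m u y‖ ≤ K) →
        ‖fderiv ℝ F (y, θ, cjetOf (EuclideanSpace.basisFun ι ℝ) 2 u y)‖ ≤ μ →
        ‖fderiv ℝ (fderiv ℝ F) (y, θ, cjetOf (EuclideanSpace.basisFun ι ℝ) 2 u y)‖ ≤ μ →
        (∀ Ω : (Fin 2 → ι) → ℝ, (∀ i j, Ω ![i, j] = Ω ![j, i]) →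
          fderiv ℝ (fderiv ℝ F) (y, θ, cjetOf (EuclideanSpace.basisFun ι ℝ) 2 u y)
            ((0 : EuclideanSpace ℝ ι), (0 : P), topJet Ω)
            ((0 : EuclideanSpace ℝ ι), (0 : P), topJet Ω) ≤ 0) →
      ∀ γ : ι → ℝ, γ ⬝ᵥ γ = 1 →
        -(A₀ * Real.sqrt (thirdSq u y) + B₀) ≤
          pair (symbolMatrix F (y, θ, cjetOf (EuclideanSpace.basisFun ι ℝ) 2 u y))
            (hessianMatrix (quadHess u γ) (EuclideanSpace.basisFun ι ℝ) y) := by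
  refine ⟨μ * (3 + 2 * K), μ * ((1 + K) ^ 2 + K), by positivity, by positivity, ?_⟩
  intro O hO u hu F θ hF hF0 y hy hKb hDF hD2F hconc γ hγ
  -- notation
  set bE := EuclideanSpace.basisFun ι ℝ with hbE
  set x₀ : EuclideanSpace ℝ ι × P × CJet ι 2 := (y, θ, cjetOf bE 2 u y) with hx₀
  set γv : EuclideanSpace ℝ ι := ∑ i, γ i • bE i with hγv
  set B := fderiv ℝ (fderiv ℝ F) x₀ with hB
  set L := fderiv ℝ F x₀ with hL
  set V₂ : CJet ι 2 := fderiv ℝ (cjetOf bE 2 u) y γv with hV₂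
  set W₂ : CJet ι 2 := fderiv ℝ (fun z => fderiv ℝ (cjetOf bE 2 u) z γv) y γv with hW₂
  set T := thirdSq u y with hT
  have hu4 : ContDiffAt ℝ 4 u y := hu.contDiffAt (hO.mem_nhds hy)
  have hu3 : ContDiffAt ℝ (2 + 1 : ℕ) u y := hu4.of_le (by norm_num)
  have hu4' : ContDiffAt ℝ (2 + 2 : ℕ) u y := hu4.of_le (by norm_num)
  have hγn : ‖γv‖ = 1 := norm_sum_smul_basisFun hγ
  have hγ1 : ‖γv‖ ≤ 1 := hγn.le
  have hT0 : 0 ≤ Real.sqrt T := Real.sqrt_nonneg _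
  -- Step 1: the twice-differentiated equation along `t ↦ y + tγ̂`
  have hid : B (γv, (0 : P), V₂) (γv, (0 : P), V₂) +
      L ((0 : EuclideanSpace ℝ ι), (0 : P), W₂) = 0 :=
    second_differential_cjetOf_eq_zero bE hO hu hF hF0 hy γv
  -- Step 2: the components of `V₂` and `W₂`
  have hV : ∀ (j : Fin 3) (I : Fin (j : ℕ) → ι),
      V₂ j I = iteratedFDeriv ℝ ((j : ℕ) + 1) u y (Fin.cons γv fun k => bE (I k)) :=
    fun j I => fderiv_cjetOf_apply bE hu3 γv j I
  have hW : ∀ (j : Fin 3) (I : Fin (j : ℕ) → ι),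
      W₂ j I = iteratedFDeriv ℝ ((j : ℕ) + 1 + 1) u y
        (Fin.cons γv (Fin.cons γv fun k => bE (I k))) :=
    fun j I => fderiv_fderiv_cjetOf_apply bE hu4' γv γv j I
  have hV2 : ∀ i j : ι, V₂ (Fin.last 2) ![i, j] = iteratedFDeriv ℝ 3 u y ![γv, bE i, bE j] :=
    fun i j => (hV (Fin.last 2) ![i, j]).trans
      (congrArg (iteratedFDeriv ℝ 3 u y) (cons_basis_two bE γv i j))
  have hW2 : ∀ i j : ι,
      W₂ (Fin.last 2) ![i, j] = iteratedFDeriv ℝ 4 u y ![γv, γv, bE i, bE j] :=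
    fun i j => (hW (Fin.last 2) ![i, j]).trans
      (congrArg (iteratedFDeriv ℝ 4 u y) (cons_cons_basis_two bE γv γv i j))
  -- Step 3: the top slots and the splittings `V = w' + s'`, `(0, 0, W₂) = lo + (0, 0, topJet Ω'')`
  set Ω' : (Fin 2 → ι) → ℝ := V₂ (Fin.last 2) with hΩ'
  set Ω'' : (Fin 2 → ι) → ℝ := W₂ (Fin.last 2) with hΩ''
  set w' : EuclideanSpace ℝ ι × P × CJet ι 2 := (γv, 0, V₂ - topJet Ω') with hw'
  set s' : EuclideanSpace ℝ ι × P × CJet ι 2 := (0, 0, topJet Ω') with hs'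
  set lo : EuclideanSpace ℝ ι × P × CJet ι 2 := (0, 0, W₂ - topJet Ω'') with hlo
  have e1 : ((γv, (0 : P), V₂) : EuclideanSpace ℝ ι × P × CJet ι 2) = w' + s' := by
    simp only [hw', hs', Prod.mk_add_mk, add_zero, sub_add_cancel]
  have e2 : (((0 : EuclideanSpace ℝ ι), (0 : P), W₂) : EuclideanSpace ℝ ι × P × CJet ι 2) =
      lo + ((0 : EuclideanSpace ℝ ι), (0 : P), topJet Ω'') := by
    simp only [hlo, Prod.mk_add_mk, add_zero, sub_add_cancel]
  -- Step 4: symmetry of the top slots (symmetry of `D³u(y)`, `D⁴u(y)`)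
  have hΩ's : ∀ i j, Ω' ![i, j] = Ω' ![j, i] := fun i j => by
    rw [hV2, hV2, iteratedFDeriv_three_swap hu4]
  have hΩ''s : ∀ i j, Ω'' ![i, j] = Ω'' ![j, i] := fun i j => by
    rw [hW2, hW2, iteratedFDeriv_four_swap hu4]
  -- Step 5: norm bounds
  have nV : ‖V₂ - topJet Ω'‖ ≤ K := by
    refine (pi_norm_le_iff_of_nonneg hK).2 fun j => (pi_norm_le_iff_of_nonneg hK).2 fun I => ?_
    rw [Pi.sub_apply, Pi.sub_apply, Real.norm_eq_abs]
    by_cases hj : j = Fin.last 2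
    · subst hj
      rw [topJet_apply_last, hΩ', sub_self, abs_zero]
      exact hK
    · rw [topJet_apply_of_ne Ω' hj, Pi.zero_apply, sub_zero, hV j I]
      have hj2 : (j : ℕ) + 1 ≤ 2 := Nat.succ_le_of_lt (Fin.val_lt_last hj)
      exact abs_apply_le_of_opNorm_le _ (hKb _ hj2) _ (norm_cons_basis_le_one bE hγ1 I)
  have nw' : ‖w'‖ ≤ 1 + K := by
    simp only [hw', Prod.norm_def, norm_zero, hγn]
    refine max_le ?_ (max_le ?_ ?_) <;> linarith [nV]
  have hΩ'b : ∀ I, |Ω' I| ≤ Real.sqrt T := fun I => by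
    rw [hΩ', hV (Fin.last 2) I]
    exact abs_apply_le_sqrt_sum_sq_apply bE _ _ (norm_cons_basis_le_one bE hγ1 I)
  have ns' : ‖s'‖ ≤ Real.sqrt T := by
    have hn : ‖s'‖ = ‖topJet Ω'‖ := by simp [hs', Prod.norm_def]
    rw [hn]
    refine (pi_norm_le_iff_of_nonneg hT0).2 fun j => ?_
    by_cases hj : j = Fin.last 2
    · subst hj
      rw [topJet_apply_last]
      exact (pi_norm_le_iff_of_nonneg hT0).2 fun I => by rw [Real.norm_eq_abs]; exact hΩ'b I
    · rw [topJet_apply_of_ne Ω' hj, norm_zero]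
      exact hT0
  have nlo : ‖lo‖ ≤ K + Real.sqrt T := by
    have h0 : (0 : ℝ) ≤ K + Real.sqrt T := by positivity
    have hn : ‖lo‖ = ‖W₂ - topJet Ω''‖ := by simp [hlo, Prod.norm_def]
    rw [hn]
    refine (pi_norm_le_iff_of_nonneg h0).2 fun j => (pi_norm_le_iff_of_nonneg h0).2 fun I => ?_
    rw [Pi.sub_apply, Pi.sub_apply, Real.norm_eq_abs]
    by_cases hj : j = Fin.last 2
    · subst hj
      rw [topJet_apply_last, hΩ'', sub_self, abs_zero]
      exact h0
    · rw [topJet_apply_of_ne Ω'' hj, Pi.zero_apply, sub_zero, hW j I]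
      by_cases hj0 : j = 0
      · -- slot `0`: `|D²u(y)(γ̂, γ̂)| ≤ ‖D²u(y)‖ ≤ K`
        subst hj0
        have hle : ((0 : Fin 3) : ℕ) + 1 + 1 ≤ 2 := by norm_num
        have h := abs_apply_le_of_opNorm_le _ (hKb _ hle) _
          (norm_cons_cons_basis_le_one bE hγ1 hγ1 I)
        exact h.trans (le_add_of_nonneg_right hT0)
      · -- slot `1`: `|D³u(y)(γ̂, γ̂, e_i)| ≤ |D³u(y)|`
        have hj1 : j = 1 := by
          rw [Fin.ext_iff, Fin.val_one]
          have h0' : (j : ℕ) ≠ 0 := fun h => hj0 (Fin.ext (by rw [h, Fin.val_zero]))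
          have := Fin.val_lt_last hj
          omega
        subst hj1
        have h := abs_apply_le_sqrt_sum_sq_apply bE (iteratedFDeriv ℝ 3 u y)
          (Fin.cons γv (Fin.cons γv fun k => bE (I k))) (norm_cons_cons_basis_le_one bE hγ1 hγ1 I)
        exact h.trans (le_add_of_nonneg_left hK)
  -- Step 6: the top-slot derivative is the pairing `a : D²h(y)`
  have hpair : L ((0 : EuclideanSpace ℝ ι), (0 : P), topJet Ω'') =
      pair (symbolMatrix F x₀) (hessianMatrix (quadHess u γ) bE y) := by
    rw [hL, fderiv_topJet_eq_pair F x₀ hΩ''s]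
    congr 1
    ext i j
    rw [Matrix.of_apply, hW2 i j, hessianMatrix_quadHess_apply hu4 γ i j,
      iteratedFDeriv_four_rotate hu4]
  -- Step 7: expand `D²F[V, V]`, use concavity on `s'` and bound the rest
  have hexp : B (γv, (0 : P), V₂) (γv, (0 : P), V₂) =
      B w' w' + B w' s' + B s' w' + B s' s' := by
    rw [e1, map_add]
    simp only [_root_.add_apply, map_add]
    ring
  have hLexp : L ((0 : EuclideanSpace ℝ ι), (0 : P), W₂) =
      L lo + L ((0 : EuclideanSpace ℝ ι), (0 : P), topJet Ω'') := by
    rw [e2, map_add]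
  have hc : B s' s' ≤ 0 := hconc Ω' hΩ's
  have hBa : ‖B‖ * ‖w'‖ ≤ μ * (1 + K) := mul_le_mul hD2F nw' (norm_nonneg _) hμ
  have hBs : ‖B‖ * ‖s'‖ ≤ μ * Real.sqrt T := mul_le_mul hD2F ns' (norm_nonneg _) hμ
  have hμK : 0 ≤ μ * (1 + K) := mul_nonneg hμ (by linarith)
  have b1 : B w' w' ≤ μ * (1 + K) * (1 + K) := by
    have h := (B w').le_opNorm w'
    rw [Real.norm_eq_abs] at h
    exact (abs_le.1 (h.trans (mul_le_mul ((B.le_opNorm w').trans hBa) nw' (norm_nonneg _)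
      hμK))).2
  have b2 : B w' s' ≤ μ * (1 + K) * Real.sqrt T := by
    have h := (B w').le_opNorm s'
    rw [Real.norm_eq_abs] at h
    exact (abs_le.1 (h.trans (mul_le_mul ((B.le_opNorm w').trans hBa) ns' (norm_nonneg _)
      hμK))).2
  have b3 : B s' w' ≤ μ * Real.sqrt T * (1 + K) := by
    have h := (B s').le_opNorm w'
    rw [Real.norm_eq_abs] at h
    exact (abs_le.1 (h.trans (mul_le_mul ((B.le_opNorm s').trans hBs) nw' (norm_nonneg _)
      (mul_nonneg hμ hT0)))).2
  have b4 : L lo ≤ μ * (K + Real.sqrt T) := by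
    have h := L.le_opNorm lo
    rw [Real.norm_eq_abs] at h
    exact (abs_le.1 (h.trans (mul_le_mul hDF nlo (norm_nonneg _) hμ))).2
  rw [← hpair]
  rw [hexp, hLexp] at hid
  have hring : μ * (3 + 2 * K) * Real.sqrt T + μ * ((1 + K) ^ 2 + K) =
      μ * (1 + K) * (1 + K) + μ * (1 + K) * Real.sqrt T + μ * Real.sqrt T * (1 + K) +
        μ * (K + Real.sqrt T) := by
    ring
  rw [hring]
  linarith

end Literature.Analysis.PDE.EvansKrylov

end
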